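import Summits.BirchSwinnertonDyer.Rank1Residual.GaloisImage.LocalThreeDivisibilityAdicCompletionAt
import Summits.BirchSwinnertonDyer.Rank1Residual.GaloisImage.LocalThreeTorsionAdicCompletionAt
import Summits.BirchSwinnertonDyer.Rank1Residual.GaloisImage.CongruenceVisibilityWitness
import Literature.NumberTheory.EllipticCurves.CongruentNumberCurveSupersingular
import Literature.NumberTheory.EllipticCurves.SelmerCorankControlRatProofs
import HarnessLib

/-!
# The witness road's hypotheses `hP`, `hdiv`, `hS` from per-prime KERNEL CERTIFICATES: a
# record-side END of `VisibleWitness.exists_sha_ne_zero_of_congr_of_locallyDivisible` over `ℚ` at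
# `p = 3` (team n1011, row T-DIV3L, FILE D5 — lead R5-83 (d) / R5-84 (e))

HONEST FRAMING (cell `b2b-bsdres`, run/shared/lean/b2b/bsd-rank1-residual/, verbatim in every
file): the goal of the cell is to DELETE the COMBINATION-SHAPED residual classes of the
Birch–Swinnerton-Dyer formula for ALL analytic-rank `≤ 1` elliptic curves over `ℚ` — "full BSD
formula for every rank `≤ 1` curve in class `C`" assembled STRICTLY from published theorems — so
that the rank-`≤ 1` remainder becomes exactly the CONSTRUCTION-SHAPED classes, which are TYPED
(missing-input `Prop`s), NOT attempted. This is not "finishing BSD". Team n1011 (N10/N11): research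
route; this file is a TOOL (assembly of kernel certificates); nothing is booked by it; no mark /
label moved; X4 stays CONSTRUCTION-SHAPED. THEOREMS + one small computable `Bool` checker (no
mathematical content); no named fact, no `sorry`. LOWER half only: the output is a non-zero element
of `Ш(E/ℚ)[3]`; `θ`, `#E(ℚ)` (finite, prime to `3`) and the discriminant supports stay INPUTS.

## What

n1011-p09's witness theorem `VisibleWitness.exists_sha_ne_zero_of_congr_of_locallyDivisible`
(`K = ℚ`, `p = 3`) asks, besides the congruence `θ` and the finiteness / coprimality of `E(ℚ)`:
a finite set of places `S` outside which both curves are good and `v ∤ 3` (`hS`), a point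
`P ∈ E′(ℚ)` with `P ∉ 3E′(ℚ)` (`hP`), and at every `v ∈ S` EITHER a cube root of `P` in `E′(ℚ_v)`
OR `v ∤ 3 ∧ #E′(ℚ_v)[3] = 1` (`hdiv`). This file supplies all three from `decide`-able data:

* `S` := the places over a prime list `L ∋ 3` supporting both integral discriminants (n1011-p18's
  (T) pattern `X4RankZeroVisibleLowerBoundPrimeList`, x11c's `X11b/VisibilityPrimeList`);
* `hP` := FILE D3 `not_mem_range_zsmul_three_of_check` at ONE auxiliary prime `ℓ₀`;
* `hdiv` := per prime `q ∈ L` a certificate from two lists — `D` (a `3`-division YES certificate,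
  FILE D4 `exists_three_nsmul_eq_adicCompletion_of_cert`) or `T` (`q ≠ 3` and a `3`-torsion count
  certificate `threeTorsionCheckAt q … = some 0`, T-LOC3L FILE L5 `free_kind_i_of_checkAt`) —
  checked by the `Bool` function `witnessLocalChecksAt`.

ENDs: **`exists_sha_ne_zero_of_congr_of_witnessChecks`** — `∃ c : Ш(E/ℚ), c ≠ 0 ∧ 3 • c = 0` from
`θ`, `Finite E(ℚ)`, `#E(ℚ)` coprime to `3`, the integer models, `L`, the witness `(x, y) ∈ E′(ℚ)`
and the three certificate checks; and the HYBRID **`…_of_relIndex`** — the same with a sub-list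
`Lrel ⊆ L` of places where the record supplies `ι_v(θ) = 1` (the local conditions agree along
`θ`; r1's kinds (ii)/(iii), n1011-p04's comparison lemmas) as a displayed hypothesis, the
certificates being asked only on `L ∖ Lrel` (n1011-p09's
`exists_sha_ne_zero_of_congr_of_locallyDivisible_or_relIndex_eq_one`; a torsion certificate gives
`ι_v(θ) = 1` by the tree's `relIndex_map_selmerLocalKer_eq_one_of_card_torsion_eq_one`). Census
(EVIDENCE, `gen9/census/div3_full_certs.json`): of r1's 535 FAIL@3 witness pairs, 202 carry
certificates at EVERY prime of `L` (pure kernel `hdiv`), the other 333 have 1–2 places of r1's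
kinds (ii)/(iii)/PAID where `P` is not `3`-divisible and `#E′(ℚ_q)[3] = 3` — the hybrid END's
`Lrel`. Consumers: the X4 ∧ `r = 0` `BSDp` twins (n1011-p03's
`X4RankZero.bsdp_*_of_congr_of_rank_two*` with the rank-`2` binder `hrank` and `hloc` REPLACED by the
witness certificates), records seats. Certificate tables: `HOME/b2b-bsdres-n1011-p17/gen9/census/`.

References: [CremonaMazur2000] §3; [AgasheStein2002] Lemma 3.6; [SilvermanAEC2009] VII.5.1(a),
Ex. 3.7(d).
-/

set_option autoImplicit false

noncomputable section

open scoped Classical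

open WeierstrassCurve NumberField IsDedekindDomain Rat.HeightOneSpectrum Field
  Literature.NumberTheory.EllipticCurves Literature.NumberTheory.GaloisRepresentations
open Summit.BirchSwinnertonDyer.Rank1Residual.GaloisImage.LocalTorsion3At
  (threeTorsionCheckAt free_kind_i_of_checkAt)

namespace Summit.BirchSwinnertonDyer.Rank1Residual.GaloisImage.DivisionDecider

/-! ### §1 The per-prime local checker and `hdiv` -/

/-- **The witness road's local checks over a prime list `L`** for the partner `E′ = ⟨a₁, …, a₆⟩`
and the witness `P` with `x(P) = num / den`: every `q ∈ L` carries EITHER an entry `(q, e)` of `D`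
with `threeDivCertAt q … e` (a cube root of `P` in `E′(ℚ_q)`, FILE D2/D3) OR an entry
`(q, k, cert)` of `T` with `q ≠ 3` and `threeTorsionCheckAt q … k cert = some 0`
(`E′(ℚ_q)[3] = 0`, T-LOC3L FILE L3). [folklore] -/
def witnessLocalChecksAt (a₁ a₂ a₃ a₄ a₆ : ℤ) (num : ℤ) (den : ℕ) (L : List ℕ)
    (D : List (ℕ × (ℤ × ℕ × ℕ × ℕ))) (T : List (ℕ × ℕ × List (ℤ × ℕ × ℕ × ℕ))) : Bool :=
  L.all fun q =>
    (D.any fun d => d.1 == q && threeDivCertAt q a₁ a₂ a₃ a₄ a₆ num den d.2) ||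
    (T.any fun t => t.1 == q && !(q == 3) &&
      threeTorsionCheckAt q a₁ a₂ a₃ a₄ a₆ t.2.1 t.2.2 == some 0)

section Local

variable (a₁ a₂ a₃ a₄ a₆ : ℤ)

/-- The integer model of an elliptic `W′ = ⟨a₁, …, a₆⟩` has non-zero integer discriminant. -/
theorem intΔ_ne_zero_of_eq (W' : WeierstrassCurve ℚ) [W'.IsElliptic]
    (hW' : W' = ⟨a₁, a₂, a₃, a₄, a₆⟩) : (⟨a₁, a₂, a₃, a₄, a₆⟩ : WeierstrassCurve ℤ).Δ ≠ 0 := by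
  intro h0
  have hmap : (⟨a₁, a₂, a₃, a₄, a₆⟩ : WeierstrassCurve ℤ).map (Int.castRingHom ℚ) = W' := by
    subst hW'; ext <;> simp [WeierstrassCurve.map]
  have hΔ : W'.Δ = (((⟨a₁, a₂, a₃, a₄, a₆⟩ : WeierstrassCurve ℤ).Δ : ℤ) : ℚ) := by
    rw [← hmap, WeierstrassCurve.map_Δ]; simp
  rw [h0, Int.cast_zero] at hΔ
  exact W'.isUnit_Δ.ne_zero hΔ

/-- The integer model of `W′ = ⟨a₁, …, a₆⟩`, mapped to `ℚ`, is `W′`. -/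
theorem map_intModel_eq (W' : WeierstrassCurve ℚ) (hW' : W' = ⟨a₁, a₂, a₃, a₄, a₆⟩) :
    (⟨a₁, a₂, a₃, a₄, a₆⟩ : WeierstrassCurve ℤ).map (Int.castRingHom ℚ) = W' := by
  subst hW'; ext <;> simp [WeierstrassCurve.map]

/-- **`hdiv` at every place over `L` from the local checks.** For the elliptic partner
`W′ = ⟨a₁, …, a₆⟩`, the witness `(x, y) ∈ E′(ℚ)` and `witnessLocalChecksAt … L D T = true`: at
every place `v` of `ℚ` whose prime lies in `L`, either `P|_{ℚ_v} ∈ 3·E′(ℚ_v)` (FILE D4) or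
`3 ∉ v ∧ #ker([3] : E′(ℚ_v)) = 1` (T-LOC3L FILE L5) — LITERALLY the disjunction `hdiv` of the
witness theorem. [folklore] -/
theorem hdiv_of_witnessLocalChecksAt (W' : WeierstrassCurve ℚ) [W'.IsElliptic]
    (hW' : W' = ⟨a₁, a₂, a₃, a₄, a₆⟩) {x y : ℚ} (h : W'.toAffine.Nonsingular x y) {L : List ℕ}
    {D : List (ℕ × (ℤ × ℕ × ℕ × ℕ))} {T : List (ℕ × ℕ × List (ℤ × ℕ × ℕ × ℕ))}
    (hc : witnessLocalChecksAt a₁ a₂ a₃ a₄ a₆ x.num x.den L D T = true)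
    (v : HeightOneSpectrum (𝓞 ℚ)) (hv : (primesEquiv v : ℕ) ∈ L) :
    (∃ Q : (W'.baseChange (v.adicCompletion ℚ)).toAffine.Point,
        (3 : ℕ) • Q = WeierstrassCurve.Affine.Point.baseChange (W' := W') ℚ (v.adicCompletion ℚ)
          (.some x y h)) ∨
      (((3 : ℕ) : 𝓞 ℚ) ∉ v.asIdeal ∧
        Nat.card (nsmulAddMonoidHom 3 : (W'.baseChange (v.adicCompletion ℚ)).toAffine.Point →+
          (W'.baseChange (v.adicCompletion ℚ)).toAffine.Point).ker = 1) := by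
  set q : ℕ := (primesEquiv v : ℕ) with hq
  haveI : Fact q.Prime := ⟨(primesEquiv v).2⟩
  have hvq : (primesEquiv v : ℕ) = q := rfl
  simp only [witnessLocalChecksAt, List.all_eq_true] at hc
  have hcq := hc q hv
  rw [Bool.or_eq_true, List.any_eq_true, List.any_eq_true] at hcq
  rcases hcq with ⟨d, -, hd⟩ | ⟨t, -, ht⟩
  · -- a `3`-division YES certificate at `q`
    rw [Bool.and_eq_true, beq_iff_eq] at hd
    obtain ⟨hd1, he⟩ := hd
    left
    exact exists_three_nsmul_eq_adicCompletion_of_cert q a₁ a₂ a₃ a₄ a₆ W' hW' hvq h he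
  · -- `q ≠ 3` and `E′(ℚ_q)[3] = 0`
    simp only [Bool.and_eq_true, beq_iff_eq, Bool.not_eq_true', beq_eq_false_iff_ne, ne_eq] at ht
    obtain ⟨⟨-, hq3⟩, hcheck⟩ := ht
    right
    exact free_kind_i_of_checkAt q a₁ a₂ a₃ a₄ a₆ hq3 (intΔ_ne_zero_of_eq a₁ a₂ a₃ a₄ a₆ W' hW')
      hcheck W' hW' hvq

end Local

/-! ### §2 The END: a visible non-zero element of `Ш(E/ℚ)[3]` from kernel certificates -/

section Main

variable (a₁ a₂ a₃ a₄ a₆ : ℤ)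

/-- **THE WITNESS ROAD FROM KERNEL CERTIFICATES (`K = ℚ`, `p = 3`).** Let `E = W`, `E′ = W′`
be elliptic curves over `ℚ` with a `Γ_ℚ`-isomorphism `θ : E′[3] ⥲ E[3]`, `E(ℚ)` finite of order
prime to `3`, integer models `E₀` of `W` and `⟨a₁, …, a₆⟩ = W′`, and a prime list `L ∋ 3` containing
every prime divisor of both discriminants. Given a point `(x, y) ∈ E′(ℚ)` with
(i) `threeNonDivCheckAt ℓ₀ … (num x) (den x) k₀` at some prime `ℓ₀` (so `P ∉ 3E′(ℚ)`, FILE D3) and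
(ii) `witnessLocalChecksAt … L D T` (a cube root of `P` in `E′(ℚ_q)` or `E′(ℚ_q)[3] = 0` with `q ≠ 3`,
for every `q ∈ L`), there is a non-zero element of `Ш(E/ℚ)` killed by `3` — n1011-p09's
`VisibleWitness.exists_sha_ne_zero_of_congr_of_locallyDivisible` with `S` = the places over `L`.
(Instance note, referee-1 GEN 34 (ix): FILE D3's `hP` END is stated with Mathlib's computable
`DecidableEq ℚ` on the point group, the witness theorem with the classical one; the `convert` in the
proof only identifies these two instances of the SAME subgroup — an instance-diamond fix, no fact.)
[cite: CremonaMazur2000, §3 and Table 1] [cite: AgasheStein2002, Lemma 3.6]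
[cite: SilvermanAEC2009, VII.5 Prop. 5.1(a)] -/
theorem exists_sha_ne_zero_of_congr_of_witnessChecks (W W' : WeierstrassCurve ℚ) [W.IsElliptic]
    [W'.IsElliptic]
    (θ : geomTorsion W' ((3 : ℕ) : ℤ) ≃+ geomTorsion W ((3 : ℕ) : ℤ))
    (hθ : ∀ (σ : Field.absoluteGaloisGroup ℚ) (P : geomTorsion W' ((3 : ℕ) : ℤ)),
      θ (σ • P) = σ • θ P)
    {E₀ : WeierstrassCurve ℤ} (hE : E₀.map (Int.castRingHom ℚ) = W)
    (hW' : W' = ⟨a₁, a₂, a₃, a₄, a₆⟩) (L : List ℕ) (h3L : 3 ∈ L)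
    (hΔE : ∀ q : ℕ, q.Prime → (q : ℤ) ∣ E₀.Δ → q ∈ L)
    (hΔF : ∀ q : ℕ, q.Prime → (q : ℤ) ∣ (⟨a₁, a₂, a₃, a₄, a₆⟩ : WeierstrassCurve ℤ).Δ → q ∈ L)
    (hfin : Finite W.toAffine.Point) (hcop : (Nat.card W.toAffine.Point).Coprime 3)
    {x y : ℚ} (h : W'.toAffine.Nonsingular x y)
    {ℓ₀ : ℕ} [hℓ₀ : Fact ℓ₀.Prime] {k₀ : ℕ}
    (hP : threeNonDivCheckAt ℓ₀ a₁ a₂ a₃ a₄ a₆ x.num x.den k₀ = true)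
    {D : List (ℕ × (ℤ × ℕ × ℕ × ℕ))} {T : List (ℕ × ℕ × List (ℤ × ℕ × ℕ × ℕ))}
    (hc : witnessLocalChecksAt a₁ a₂ a₃ a₄ a₆ x.num x.den L D T = true) :
    ∃ c : W.sha, c ≠ 0 ∧ 3 • c = 0 := by
  haveI : Fact (Nat.Prime 3) := ⟨Nat.prime_three⟩
  set e := primesEquiv (R := 𝓞 ℚ) with he
  -- the finite set of places over `L` (n1011-p18's (T) construction)
  set S : Finset (HeightOneSpectrum (𝓞 ℚ)) :=
    (L.filterMap fun q ↦ if hq : q.Prime then some (e.symm ⟨q, hq⟩) else none).toFinset with hSdef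
  have hmemS : ∀ v : HeightOneSpectrum (𝓞 ℚ), v ∈ S ↔ (e v : ℕ) ∈ L := by
    intro v
    rw [hSdef, List.mem_toFinset, List.mem_filterMap]
    constructor
    · rintro ⟨q, hq, hqv⟩
      by_cases hqp : q.Prime
      · rw [dif_pos hqp, Option.some.injEq] at hqv
        rw [← hqv, Equiv.apply_symm_apply]
        exact hq
      · rw [dif_neg hqp] at hqv
        exact absurd hqv (by simp)
    · intro hv
      refine ⟨(e v : ℕ), hv, ?_⟩
      rw [dif_pos (e v).2]
      simp
  have hF := map_intModel_eq a₁ a₂ a₃ a₄ a₆ W' hW'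
  -- `hP` (FILE D3; the point group's `DecidableEq ℚ` instance there is the computable one, the
  -- witness theorem carries the classical one — same subgroup, `convert` closes the difference)
  refine VisibleWitness.exists_sha_ne_zero_of_congr_of_locallyDivisible W W' (p := 3) (by norm_num)
    θ hθ S (fun v hvS ↦ ?_) hfin hcop (.some x y h)
    (by convert not_mem_range_zsmul_three_of_check ℓ₀ a₁ a₂ a₃ a₄ a₆ W' hW' h hP)
    (fun v hvS ↦ hdiv_of_witnessLocalChecksAt a₁ a₂ a₃ a₄ a₆ W' hW' h hc v ((hmemS v).mp hvS))
  -- outside `S`: both curves good (Silverman VII.5.1(a)) and `v ∤ 3`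
  have hvL : (e v : ℕ) ∉ L := fun h' ↦ hvS ((hmemS v).mpr h')
  have hqp : (e v : ℕ).Prime := (e v).2
  refine ⟨?_, ?_, fun h3v ↦ hvL ?_⟩
  · rw [← hE]
    exact hasGoodReductionAt_map_of_not_dvd E₀ v fun h' ↦ hvL (hΔE _ hqp h')
  · rw [← hF]
    exact hasGoodReductionAt_map_of_not_dvd _ v fun h' ↦ hvL (hΔF _ hqp h')
  · rw [he, Rat.HeightOneSpectrum.primesEquiv_eq_of_natCast_mem v Nat.prime_three h3v]
    exact h3L

/-- **THE HYBRID WITNESS ROAD: kernel certificates on `L ∖ Lrel`, comparison `ι_v(θ) = 1` on `Lrel`.**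
As `exists_sha_ne_zero_of_congr_of_witnessChecks`, but at the places over a sub-list `Lrel` the
record supplies `ι_v(θ) = 1` (the local conditions of `E` and `E′` agree along `θ`: r1's kinds
(ii)/(iii); n1011-p04's comparison criteria) as the displayed hypothesis `hrel`, and the
certificates `witnessLocalChecksAt` are asked only on `L.filter (· ∉ Lrel)`; a torsion certificate
there yields `ι_v(θ) = 1` by the tree's `relIndex_map_selmerLocalKer_eq_one_of_card_torsion_eq_one`
(Milne ADT I 3.3). n1011-p09's `exists_sha_ne_zero_of_congr_of_locallyDivisible_or_relIndex_eq_one`.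
[cite: CremonaMazur2000, §3 and Table 1] [cite: AgasheStein2002, Lemma 3.6]
[cite: MilneADT2006, I Lemma 3.3] -/
theorem exists_sha_ne_zero_of_congr_of_witnessChecks_of_relIndex (W W' : WeierstrassCurve ℚ)
    [W.IsElliptic] [W'.IsElliptic]
    (θ : geomTorsion W' ((3 : ℕ) : ℤ) ≃+ geomTorsion W ((3 : ℕ) : ℤ))
    (hθ : ∀ (σ : Field.absoluteGaloisGroup ℚ) (P : geomTorsion W' ((3 : ℕ) : ℤ)),
      θ (σ • P) = σ • θ P)
    {E₀ : WeierstrassCurve ℤ} (hE : E₀.map (Int.castRingHom ℚ) = W)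
    (hW' : W' = ⟨a₁, a₂, a₃, a₄, a₆⟩) (L : List ℕ) (h3L : 3 ∈ L)
    (hΔE : ∀ q : ℕ, q.Prime → (q : ℤ) ∣ E₀.Δ → q ∈ L)
    (hΔF : ∀ q : ℕ, q.Prime → (q : ℤ) ∣ (⟨a₁, a₂, a₃, a₄, a₆⟩ : WeierstrassCurve ℤ).Δ → q ∈ L)
    (hfin : Finite W.toAffine.Point) (hcop : (Nat.card W.toAffine.Point).Coprime 3)
    {x y : ℚ} (h : W'.toAffine.Nonsingular x y)
    {ℓ₀ : ℕ} [hℓ₀ : Fact ℓ₀.Prime] {k₀ : ℕ}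
    (hP : threeNonDivCheckAt ℓ₀ a₁ a₂ a₃ a₄ a₆ x.num x.den k₀ = true)
    (Lrel : List ℕ)
    (hrel : ∀ v : HeightOneSpectrum (𝓞 ℚ), (primesEquiv v : ℕ) ∈ Lrel →
      (selmerLocalKer W (v.adicCompletion ℚ) ((3 : ℕ) : ℤ)).relIndex
        ((selmerLocalKer W' (v.adicCompletion ℚ) ((3 : ℕ) : ℤ)).map
          (h1Equiv θ hθ).toAddMonoidHom) = 1)
    {D : List (ℕ × (ℤ × ℕ × ℕ × ℕ))} {T : List (ℕ × ℕ × List (ℤ × ℕ × ℕ × ℕ))}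
    (hc : witnessLocalChecksAt a₁ a₂ a₃ a₄ a₆ x.num x.den (L.filter fun q => q ∉ Lrel) D T = true) :
    ∃ c : W.sha, c ≠ 0 ∧ 3 • c = 0 := by
  haveI : Fact (Nat.Prime 3) := ⟨Nat.prime_three⟩
  set e := primesEquiv (R := 𝓞 ℚ) with he
  set S : Finset (HeightOneSpectrum (𝓞 ℚ)) :=
    (L.filterMap fun q ↦ if hq : q.Prime then some (e.symm ⟨q, hq⟩) else none).toFinset with hSdef
  have hmemS : ∀ v : HeightOneSpectrum (𝓞 ℚ), v ∈ S ↔ (e v : ℕ) ∈ L := by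
    intro v
    rw [hSdef, List.mem_toFinset, List.mem_filterMap]
    constructor
    · rintro ⟨q, hq, hqv⟩
      by_cases hqp : q.Prime
      · rw [dif_pos hqp, Option.some.injEq] at hqv
        rw [← hqv, Equiv.apply_symm_apply]
        exact hq
      · rw [dif_neg hqp] at hqv
        exact absurd hqv (by simp)
    · intro hv
      refine ⟨(e v : ℕ), hv, ?_⟩
      rw [dif_pos (e v).2]
      simp
  have hF := map_intModel_eq a₁ a₂ a₃ a₄ a₆ W' hW'
  refine VisibleWitness.exists_sha_ne_zero_of_congr_of_locallyDivisible_or_relIndex_eq_one W W'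
    (p := 3) (by norm_num) θ hθ S (fun v hvS ↦ ?_) hfin hcop (.some x y h)
    (by convert not_mem_range_zsmul_three_of_check ℓ₀ a₁ a₂ a₃ a₄ a₆ W' hW' h hP)
    (fun v hvS ↦ ?_)
  · -- outside `S`
    have hvL : (e v : ℕ) ∉ L := fun h' ↦ hvS ((hmemS v).mpr h')
    have hqp : (e v : ℕ).Prime := (e v).2
    refine ⟨?_, ?_, fun h3v ↦ hvL ?_⟩
    · rw [← hE]
      exact hasGoodReductionAt_map_of_not_dvd E₀ v fun h' ↦ hvL (hΔE _ hqp h')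
    · rw [← hF]
      exact hasGoodReductionAt_map_of_not_dvd _ v fun h' ↦ hvL (hΔF _ hqp h')
    · rw [he, Rat.HeightOneSpectrum.primesEquiv_eq_of_natCast_mem v Nat.prime_three h3v]
      exact h3L
  · -- at `v ∈ S`: comparison place, or a certificate
    by_cases hvrel : (e v : ℕ) ∈ Lrel
    · exact Or.inr (hrel v hvrel)
    · have hvL' : (e v : ℕ) ∈ L.filter fun q => q ∉ Lrel := by
        rw [List.mem_filter]
        exact ⟨(hmemS v).mp hvS, by simpa using hvrel⟩
      rcases hdiv_of_witnessLocalChecksAt a₁ a₂ a₃ a₄ a₆ W' hW' h hc v hvL' with hdiv | ⟨h3v, hcard⟩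
      · exact Or.inl hdiv
      · exact Or.inr (WeierstrassCurve.relIndex_map_selmerLocalKer_eq_one_of_card_torsion_eq_one
          W W' θ hθ h3v hcard)

end Main

end Summit.BirchSwinnertonDyer.Rank1Residual.GaloisImage.DivisionDecider

end
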